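import Literature.AlgebraicGeometry.ShimuraVarieties.UnitaryShimuraCurveRecord
import Literature.AlgebraicGeometry.ModuliOfAbelianVarieties.SiegelShimuraSet
import Literature.AlgebraicGeometry.ModuliOfAbelianVarieties.SiegelComplexRecordSystem
import HarnessLib

/-!
# The mover of the Siegel chart AT ANY REPRESENTATIVE of a class of the unitary Shimura curve

Topic `AlgebraicGeometry/ShimuraVarieties`; namespace `Literature.AlgebraicGeometry.ShimuraVarieties.UnitaryCurve`.  THEOREMS ONLY (no `def`, no named
fact, no instance, no notation, no `sorry`).  Cell `hodgecm-mathlib` (D-0151), FLOOR 0, P6 «MOD», line L6 = the Σ-GAL half of `stub_E6` (E-line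
`Cruxes/HLiu418/Lines/F0_P6a_PELWitnessE.lean`), (K-a) representative bookkeeping; `--supports stmt-HodgeConjecture-24832`, count-neutral; HC_CM is proved
only modulo the printed citations (2 remaining named inputs hLiu418 24832, h413 24833) until rung 0 closes.

WHY.  The Σ-AN socket (`ReadsCReading`) reads the fibre at a complex point `x` of the record curve through an admissible marking by
`[J(Z a v), rep (piece a)]` for SOME representative `(v, a)` of the class `pts x ∈ Sh_K(U(J⋆))(ℂ)` (∃-representative form), whereas the CM datum of the
chart (E-line ED. 5 field `cm_recip`, ★ `F0P6aSpecialPairRecipDatumOfChart`) sits at the SPECIAL representative `(ι₁ w, a₀)` of the same class, at the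
complex structure `J(ι₁ w)`.  The Σ-GAL kernel instance (★ `F0P6aCMHomKernelShape.exists_cmConjHom_kernelShape_frame`) bridges the two by a MOVER:
a rational similitude `q₁` with `q₁_ℝ⁻¹ · J(v₀) · q₁_ℝ = J(Z a v)` and `q₁_𝔸 · rep (piece a) ≡ b a₀ (mod K_δ(N))` (its hypotheses `hJ₁`, `hq₁`).  This file
produces that mover from the chart's own laws, for ANY two representatives of one class:
* §1 `exists_mover_of_mk_eq_mk` — if `[v, aK] = [v₀, a₀K]` in `Sh_K(U(J⋆))(ℂ)` then `q₁ := (bq γ)⁻¹ · q a` (γ the rational element relating the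
  representatives, ★ `ShimuraSetGS.mk_eq_mk_iff`) satisfies `q₁_ℝ⁻¹ J(v₀) q₁_ℝ = J(Z a v)` (by `J(c·γv₀) = J(γv₀) = (bq γ)_ℝ J(v₀) (bq γ)_ℝ⁻¹` — the chart's
  `hJsmul`, `hJrat` — and the mover law `(q a)_ℝ⁻¹ J(v) (q a)_ℝ = J(Z a v)`) and `q₁_𝔸 · rep (piece a) K_δ(N) = b(a₀) K_δ(N)` (by `(q a)_𝔸 rep(piece a) ≡ b a`,
  `a ≡ γ a₀ (mod K)`, `b γ = (bq γ)_𝔸`, `b(K) ⊆ K_δ(N)`).  All hypotheses are fields of the E-line's `AuxChartGS` token for token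
  (`hJsmul hb hJrat hle q_spec`), stated here over abstract data.

## References
* [Milne2005ShimuraVarieties] J. S. Milne, *Introduction to Shimura varieties* (2005): §5 (5.1) p. 56, Lemma 5.13 p. 57, §6 p. 68.
* [Deligne1971TravauxShimura] P. Deligne, *Travaux de Shimura* (1971): 1.8 p. 129, Déf. 3.13 p. 141, 5.1 p. 153.
-/

set_option autoImplicit false

noncomputable section

open Matrix NumberField IsDedekindDomain
open Literature.NumberTheory.Automorphic Literature.NumberTheory.Automorphic.UnitaryGroup
open Literature.AlgebraicGeometry.ModuliOfAbelianVarieties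
open Literature.AlgebraicGeometry.ModuliOfAbelianVarieties.SiegelModuli (jOfSiegel)

namespace Literature.AlgebraicGeometry.ShimuraVarieties

open UnitaryCanonicalModel

namespace UnitaryCurve

variable {L : Type} [Field L] [NumberField L] [IsCMField L] {Jstar : Matrix (Fin 2) (Fin 2) L} {τ : L →+* ℂ}
variable {g N : ℕ} {δ : Fin g → ℕ}

/-! ### §1. The mover at any representative of a class -/

/-- **THE MOVER AT ANY REPRESENTATIVE OF A CLASS** ([Milne2005ShimuraVarieties] Lemma 5.13; [Deligne1971TravauxShimura] 5.1): for a Hodge-embedding datum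
`J` constant on lines (`hJsmul`) and `U(J⋆)(L⁺)`-equivariant through `bq` (`hJrat`), a group map `b` agreeing with `bq` on rational points (`hb`) with
`b(K) ⊆ K_δ(N)` (`hle`), and a chart `(piece, Z, rep, q)` obeying the MOVER LAW `(q a)_ℝ⁻¹ J(v) (q a)_ℝ = J(Z a v)`, `(q a)_𝔸 · rep(piece a) K_δ(N) = b(a) K_δ(N)`
(`q_spec` — ★ `UnitaryCurve.exists_siegelChartGS_mover` clause (Q), the E-line's `AuxChartGS.q_spec`): whenever two pairs represent the SAME class,
`[v, aK] = [v₀, a₀K]`, there is a rational similitude `q₁ ∈ GSp_δ(ℚ)` with `q₁_ℝ⁻¹ · J(v₀) · q₁_ℝ = J(Z a v)` and `q₁_𝔸 · rep(piece a) K_δ(N) = b(a₀) K_δ(N)` —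
the hypotheses `hJ₁`∕`hq₁` of ★ `F0P6aCMHomKernelShape.exists_cmConjHom_kernelShape_frame` for the marking of the Σ-AN socket at `(v, a)` against the CM
datum at `(v₀, a₀) = (ι₁ w, a₀)`.  (`q₁ = (bq γ)⁻¹ · q a` for the `γ` of ★ `ShimuraSetGS.mk_eq_mk_iff`.)
[cite: Milne2005ShimuraVarieties, §5 (5.1) p. 56, Lemma 5.13 p. 57 and §6 p. 68] [cite: Deligne1971TravauxShimura, Déf. 3.13 p. 141 and 5.1 p. 153] -/
theorem exists_mover_of_mk_eq_mk
    (J : (Fin 2 → ℂ) → Matrix (Fin g ⊕ Fin g) (Fin g ⊕ Fin g) ℝ)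
    (hJsmul : ∀ c : ℂ, c ≠ 0 → ∀ v : Fin 2 → ℂ, v ∈ negCone (Jstar.map τ) → J (c • v) = J v)
    (b : ↥(finAdelic (↥(maximalRealSubfield L)) L (IsCMField.complexConj L) 2 Jstar) →* ↥(gspFinAdelic δ))
    (bq : ↥(rational (↥(maximalRealSubfield L)) L (IsCMField.complexConj L) 2 Jstar) →* ↥(gspRational δ))
    (hb : ∀ γ : ↥(rational (↥(maximalRealSubfield L)) L (IsCMField.complexConj L) 2 Jstar),
      b (rationalToFinAdelic (↥(maximalRealSubfield L)) L (IsCMField.complexConj L) 2 Jstar γ) = gspRationalToFinAdelic δ (bq γ))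
    (hJrat : ∀ (γ : ↥(rational (↥(maximalRealSubfield L)) L (IsCMField.complexConj L) 2 Jstar)) (v : Fin 2 → ℂ),
      v ∈ negCone (Jstar.map τ) →
        J (((ratToGLℂ L Jstar τ γ : GL (Fin 2) ℂ) : Matrix (Fin 2) (Fin 2) ℂ) *ᵥ v) =
          conjJ ((gspRationalToReal δ (bq γ) : ↥(gspReal δ)) : GL (Fin g ⊕ Fin g) ℝ) (J v))
    (K : Subgroup ↥(finAdelic (↥(maximalRealSubfield L)) L (IsCMField.complexConj L) 2 Jstar))
    (hle : K ≤ (principalLevelSubgroup δ N).comap b)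
    (piece : ↥(finAdelic (↥(maximalRealSubfield L)) L (IsCMField.complexConj L) 2 Jstar) → (ZMod N)ˣ)
    (Z : ↥(finAdelic (↥(maximalRealSubfield L)) L (IsCMField.complexConj L) 2 Jstar) → (Fin 2 → ℂ) → Matrix (Fin g) (Fin g) ℂ)
    (rep : (ZMod N)ˣ → ↥(gspFinAdelic δ))
    (q : ↥(finAdelic (↥(maximalRealSubfield L)) L (IsCMField.complexConj L) 2 Jstar) → ↥(gspRational δ))
    (q_spec : ∀ (v : Fin 2 → ℂ), v ∈ negCone (Jstar.map τ) → ∀ a : ↥(finAdelic (↥(maximalRealSubfield L)) L (IsCMField.complexConj L) 2 Jstar),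
      conjJ (((gspRationalToReal δ (q a))⁻¹ : ↥(gspReal δ)) : GL (Fin g ⊕ Fin g) ℝ) (J v) = jOfSiegel δ (Z a v) ∧
        gspRationalToFinAdelic δ (q a) • ((rep (piece a) : ↥(gspFinAdelic δ)) : ↥(gspFinAdelic δ) ⧸ principalLevelSubgroup δ N) =
          ((b a : ↥(gspFinAdelic δ)) : ↥(gspFinAdelic δ) ⧸ principalLevelSubgroup δ N))
    (v : Fin 2 → ℂ) (hv : v ∈ negCone (Jstar.map τ)) (a : ↥(finAdelic (↥(maximalRealSubfield L)) L (IsCMField.complexConj L) 2 Jstar))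
    (v₀ : Fin 2 → ℂ) (hv₀ : v₀ ∈ negCone (Jstar.map τ)) (a₀ : ↥(finAdelic (↥(maximalRealSubfield L)) L (IsCMField.complexConj L) 2 Jstar))
    (h : ShimuraSetGS.mk L Jstar τ K v hv a = ShimuraSetGS.mk L Jstar τ K v₀ hv₀ a₀) :
    ∃ q₁ : ↥(gspRational δ),
      conjJ (((gspRationalToReal δ q₁)⁻¹ : ↥(gspReal δ)) : GL (Fin g ⊕ Fin g) ℝ) (J v₀) = jOfSiegel δ (Z a v) ∧
        gspRationalToFinAdelic δ q₁ • ((rep (piece a) : ↥(gspFinAdelic δ)) : ↥(gspFinAdelic δ) ⧸ principalLevelSubgroup δ N) =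
          ((b a₀ : ↥(gspFinAdelic δ)) : ↥(gspFinAdelic δ) ⧸ principalLevelSubgroup δ N) := by
  obtain ⟨γ, c, hc, hγv, hγa⟩ := (ShimuraSetGS.mk_eq_mk_iff L Jstar τ K v v₀ hv hv₀ a a₀).1 h
  -- `J(v) = (bq γ)_ℝ · J(v₀) · (bq γ)_ℝ⁻¹`
  have hmem : ((ratToGLℂ L Jstar τ γ : GL (Fin 2) ℂ) : Matrix (Fin 2) (Fin 2) ℂ) *ᵥ v₀ ∈ negCone (Jstar.map τ) := by
    simpa only [one_smul] using smul_ratToGLℂ_mulVec_mem_negCone L Jstar τ γ one_ne_zero hv₀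
  have hJv : J v = conjJ ((gspRationalToReal δ (bq γ) : ↥(gspReal δ)) : GL (Fin g ⊕ Fin g) ℝ) (J v₀) := by
    rw [← hγv, hJsmul c hc _ hmem, hJrat γ v₀ hv₀]
  -- `a = γ a₀ k`, `k ∈ K`, so `b a = (bq γ)_𝔸 · b a₀ · b k` with `b k ∈ K_δ(N)`
  have hk : (rationalToFinAdelic (↥(maximalRealSubfield L)) L (IsCMField.complexConj L) 2 Jstar γ * a₀)⁻¹ * a ∈ K := by
    have h' := hγa
    rw [MulAction.Quotient.smul_coe, smul_eq_mul] at h'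
    exact QuotientGroup.eq.1 h'
  have hba : b a = gspRationalToFinAdelic δ (bq γ) * b a₀ *
      b ((rationalToFinAdelic (↥(maximalRealSubfield L)) L (IsCMField.complexConj L) 2 Jstar γ * a₀)⁻¹ * a) := by
    rw [← hb, ← map_mul, ← map_mul, mul_inv_cancel_left]
  have hbk : b ((rationalToFinAdelic (↥(maximalRealSubfield L)) L (IsCMField.complexConj L) 2 Jstar γ * a₀)⁻¹ * a) ∈
      principalLevelSubgroup δ N := hle hk
  refine ⟨(bq γ)⁻¹ * q a, ?_, ?_⟩
  · -- `((bq γ)⁻¹ q a)_ℝ⁻¹ = (q a)_ℝ⁻¹ · (bq γ)_ℝ`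
    rw [map_mul, map_inv, _root_.mul_inv_rev, inv_inv, Subgroup.coe_mul, conjJ_mul, ← hJv]
    exact (q_spec v hv a).1
  · rw [map_mul, map_inv, mul_smul, (q_spec v hv a).2, MulAction.Quotient.smul_coe, smul_eq_mul, hba, mul_assoc,
      inv_mul_cancel_left]
    exact QuotientGroup.mk_mul_of_mem _ hbk

/-! ### §2 (ED. 2). The same mover also conjugates the FRAME READING: `(Mρ a b)_ℚ = q₁⁻¹ · (ρ₀ b)_ℚ · q₁` under (D-lin) -/

/-- **THE MOVER AT ANY REPRESENTATIVE ALSO READS THE LATTICE ACTION** — §1 plus the frame law: if moreover the chart's lattice reading is the mover-conjugate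
of an integral action `ρ₀` (`Mρ_frame`: `(Mρ a b)_ℚ = (q a)⁻¹ · (ρ₀ b)_ℚ · (q a)`, ★ `UnitaryCurve.AuxV.exists_chartActionReading_frame`, E-line ED. 5 field) and the
rational Hodge embedding commutes with that action ((D-lin): `(bq γ) · (ρ₀ b)_ℚ = (ρ₀ b)_ℚ · (bq γ)` — `U(J⋆)(F⁺)` acts `F`-linearly and `ρ₀` is the action of the
scalars; A-p15 (g19)'s requested ED. 5 field `bq_comm_ρ₀`), then the mover `q₁` of §1 ALSO satisfies `(Mρ a b)_ℚ = q₁⁻¹ · (ρ₀ b)_ℚ · q₁` — the `hM₁`∕`hM₂`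
hypothesis of ★ `F0P6aCMHomKernelShape.exists_cmConjHom_kernelShape_frame` for the Σ-AN representative `(v, a)` against the CM datum at `(v₀, a₀)`.
[cite: Milne2005ShimuraVarieties, §5 (5.1) p. 56, Lemma 5.13 p. 57 and §6 p. 68] [cite: Deligne1971TravauxShimura, Déf. 3.13 p. 141 and 5.1 p. 153] -/
theorem exists_mover_of_mk_eq_mk_frame
    (J : (Fin 2 → ℂ) → Matrix (Fin g ⊕ Fin g) (Fin g ⊕ Fin g) ℝ)
    (hJsmul : ∀ c : ℂ, c ≠ 0 → ∀ v : Fin 2 → ℂ, v ∈ negCone (Jstar.map τ) → J (c • v) = J v)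
    (b : ↥(finAdelic (↥(maximalRealSubfield L)) L (IsCMField.complexConj L) 2 Jstar) →* ↥(gspFinAdelic δ))
    (bq : ↥(rational (↥(maximalRealSubfield L)) L (IsCMField.complexConj L) 2 Jstar) →* ↥(gspRational δ))
    (hb : ∀ γ : ↥(rational (↥(maximalRealSubfield L)) L (IsCMField.complexConj L) 2 Jstar),
      b (rationalToFinAdelic (↥(maximalRealSubfield L)) L (IsCMField.complexConj L) 2 Jstar γ) = gspRationalToFinAdelic δ (bq γ))
    (hJrat : ∀ (γ : ↥(rational (↥(maximalRealSubfield L)) L (IsCMField.complexConj L) 2 Jstar)) (v : Fin 2 → ℂ),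
      v ∈ negCone (Jstar.map τ) →
        J (((ratToGLℂ L Jstar τ γ : GL (Fin 2) ℂ) : Matrix (Fin 2) (Fin 2) ℂ) *ᵥ v) =
          conjJ ((gspRationalToReal δ (bq γ) : ↥(gspReal δ)) : GL (Fin g ⊕ Fin g) ℝ) (J v))
    (K : Subgroup ↥(finAdelic (↥(maximalRealSubfield L)) L (IsCMField.complexConj L) 2 Jstar))
    (hle : K ≤ (principalLevelSubgroup δ N).comap b)
    (piece : ↥(finAdelic (↥(maximalRealSubfield L)) L (IsCMField.complexConj L) 2 Jstar) → (ZMod N)ˣ)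
    (Z : ↥(finAdelic (↥(maximalRealSubfield L)) L (IsCMField.complexConj L) 2 Jstar) → (Fin 2 → ℂ) → Matrix (Fin g) (Fin g) ℂ)
    (rep : (ZMod N)ˣ → ↥(gspFinAdelic δ))
    (q : ↥(finAdelic (↥(maximalRealSubfield L)) L (IsCMField.complexConj L) 2 Jstar) → ↥(gspRational δ))
    (q_spec : ∀ (v : Fin 2 → ℂ), v ∈ negCone (Jstar.map τ) → ∀ a : ↥(finAdelic (↥(maximalRealSubfield L)) L (IsCMField.complexConj L) 2 Jstar),
      conjJ (((gspRationalToReal δ (q a))⁻¹ : ↥(gspReal δ)) : GL (Fin g ⊕ Fin g) ℝ) (J v) = jOfSiegel δ (Z a v) ∧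
        gspRationalToFinAdelic δ (q a) • ((rep (piece a) : ↥(gspFinAdelic δ)) : ↥(gspFinAdelic δ) ⧸ principalLevelSubgroup δ N) =
          ((b a : ↥(gspFinAdelic δ)) : ↥(gspFinAdelic δ) ⧸ principalLevelSubgroup δ N))
    -- the frame reading (E-line ED. 5 `ρ₀`, `Mρ`, `Mρ_frame`) and (D-lin)
    {B : Type} (ρ₀ : B → Matrix (Fin g ⊕ Fin g) (Fin g ⊕ Fin g) ℤ)
    (Mρ : ↥(finAdelic (↥(maximalRealSubfield L)) L (IsCMField.complexConj L) 2 Jstar) → B → Matrix (Fin g ⊕ Fin g) (Fin g ⊕ Fin g) ℤ)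
    (Mρ_frame : ∀ (v : Fin 2 → ℂ), v ∈ negCone (Jstar.map τ) →
      ∀ (a : ↥(finAdelic (↥(maximalRealSubfield L)) L (IsCMField.complexConj L) 2 Jstar)) (b' : B),
        (Mρ a b').map (Int.cast : ℤ → ℚ) =
          ((((q a)⁻¹ : ↥(gspRational δ)) : GL (Fin g ⊕ Fin g) ℚ) : Matrix (Fin g ⊕ Fin g) (Fin g ⊕ Fin g) ℚ) * (ρ₀ b').map (Int.cast : ℤ → ℚ) *
            (((q a : ↥(gspRational δ)) : GL (Fin g ⊕ Fin g) ℚ) : Matrix (Fin g ⊕ Fin g) (Fin g ⊕ Fin g) ℚ))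
    (hDlin : ∀ (γ : ↥(rational (↥(maximalRealSubfield L)) L (IsCMField.complexConj L) 2 Jstar)) (b' : B),
      (((bq γ : ↥(gspRational δ)) : GL (Fin g ⊕ Fin g) ℚ) : Matrix (Fin g ⊕ Fin g) (Fin g ⊕ Fin g) ℚ) * (ρ₀ b').map (Int.cast : ℤ → ℚ) =
        (ρ₀ b').map (Int.cast : ℤ → ℚ) * (((bq γ : ↥(gspRational δ)) : GL (Fin g ⊕ Fin g) ℚ) : Matrix (Fin g ⊕ Fin g) (Fin g ⊕ Fin g) ℚ))
    (v : Fin 2 → ℂ) (hv : v ∈ negCone (Jstar.map τ)) (a : ↥(finAdelic (↥(maximalRealSubfield L)) L (IsCMField.complexConj L) 2 Jstar))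
    (v₀ : Fin 2 → ℂ) (hv₀ : v₀ ∈ negCone (Jstar.map τ)) (a₀ : ↥(finAdelic (↥(maximalRealSubfield L)) L (IsCMField.complexConj L) 2 Jstar))
    (h : ShimuraSetGS.mk L Jstar τ K v hv a = ShimuraSetGS.mk L Jstar τ K v₀ hv₀ a₀) :
    ∃ q₁ : ↥(gspRational δ),
      conjJ (((gspRationalToReal δ q₁)⁻¹ : ↥(gspReal δ)) : GL (Fin g ⊕ Fin g) ℝ) (J v₀) = jOfSiegel δ (Z a v) ∧
        gspRationalToFinAdelic δ q₁ • ((rep (piece a) : ↥(gspFinAdelic δ)) : ↥(gspFinAdelic δ) ⧸ principalLevelSubgroup δ N) =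
          ((b a₀ : ↥(gspFinAdelic δ)) : ↥(gspFinAdelic δ) ⧸ principalLevelSubgroup δ N) ∧
        ∀ b' : B, (Mρ a b').map (Int.cast : ℤ → ℚ) =
          (((q₁⁻¹ : ↥(gspRational δ)) : GL (Fin g ⊕ Fin g) ℚ) : Matrix (Fin g ⊕ Fin g) (Fin g ⊕ Fin g) ℚ) * (ρ₀ b').map (Int.cast : ℤ → ℚ) *
            (((q₁ : ↥(gspRational δ)) : GL (Fin g ⊕ Fin g) ℚ) : Matrix (Fin g ⊕ Fin g) (Fin g ⊕ Fin g) ℚ) := by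
  obtain ⟨γ, c, hc, hγv, hγa⟩ := (ShimuraSetGS.mk_eq_mk_iff L Jstar τ K v v₀ hv hv₀ a a₀).1 h
  -- `J(v) = (bq γ)_ℝ · J(v₀) · (bq γ)_ℝ⁻¹`
  have hmem : ((ratToGLℂ L Jstar τ γ : GL (Fin 2) ℂ) : Matrix (Fin 2) (Fin 2) ℂ) *ᵥ v₀ ∈ negCone (Jstar.map τ) := by
    simpa only [one_smul] using smul_ratToGLℂ_mulVec_mem_negCone L Jstar τ γ one_ne_zero hv₀
  have hJv : J v = conjJ ((gspRationalToReal δ (bq γ) : ↥(gspReal δ)) : GL (Fin g ⊕ Fin g) ℝ) (J v₀) := by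
    rw [← hγv, hJsmul c hc _ hmem, hJrat γ v₀ hv₀]
  -- `a = γ a₀ k`, `k ∈ K`, so `b a = (bq γ)_𝔸 · b a₀ · b k` with `b k ∈ K_δ(N)`
  have hk : (rationalToFinAdelic (↥(maximalRealSubfield L)) L (IsCMField.complexConj L) 2 Jstar γ * a₀)⁻¹ * a ∈ K := by
    have h' := hγa
    rw [MulAction.Quotient.smul_coe, smul_eq_mul] at h'
    exact QuotientGroup.eq.1 h'
  have hba : b a = gspRationalToFinAdelic δ (bq γ) * b a₀ *
      b ((rationalToFinAdelic (↥(maximalRealSubfield L)) L (IsCMField.complexConj L) 2 Jstar γ * a₀)⁻¹ * a) := by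
    rw [← hb, ← map_mul, ← map_mul, mul_inv_cancel_left]
  have hbk : b ((rationalToFinAdelic (↥(maximalRealSubfield L)) L (IsCMField.complexConj L) 2 Jstar γ * a₀)⁻¹ * a) ∈
      principalLevelSubgroup δ N := hle hk
  refine ⟨(bq γ)⁻¹ * q a, ?_, ?_, fun b' => ?_⟩
  · -- `((bq γ)⁻¹ q a)_ℝ⁻¹ = (q a)_ℝ⁻¹ · (bq γ)_ℝ`
    rw [map_mul, map_inv, _root_.mul_inv_rev, inv_inv, Subgroup.coe_mul, conjJ_mul, ← hJv]
    exact (q_spec v hv a).1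
  · rw [map_mul, map_inv, mul_smul, (q_spec v hv a).2, MulAction.Quotient.smul_coe, smul_eq_mul, hba, mul_assoc,
      inv_mul_cancel_left]
    exact QuotientGroup.mk_mul_of_mem _ hbk
  · -- `((bq γ)⁻¹ q a)⁻¹ · ρ₀ · ((bq γ)⁻¹ q a) = (q a)⁻¹ · (bq γ · ρ₀ · (bq γ)⁻¹) · (q a) = (q a)⁻¹ · ρ₀ · (q a)` by (D-lin)
    have hγρ : (((bq γ : ↥(gspRational δ)) : GL (Fin g ⊕ Fin g) ℚ) : Matrix (Fin g ⊕ Fin g) (Fin g ⊕ Fin g) ℚ) * (ρ₀ b').map (Int.cast : ℤ → ℚ) *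
        ((((bq γ)⁻¹ : ↥(gspRational δ)) : GL (Fin g ⊕ Fin g) ℚ) : Matrix (Fin g ⊕ Fin g) (Fin g ⊕ Fin g) ℚ) = (ρ₀ b').map (Int.cast : ℤ → ℚ) := by
      rw [hDlin γ b', Matrix.mul_assoc, Subgroup.coe_inv, Units.mul_inv, Matrix.mul_one]
    have key : ((((q a)⁻¹ : ↥(gspRational δ)) : GL (Fin g ⊕ Fin g) ℚ) : Matrix (Fin g ⊕ Fin g) (Fin g ⊕ Fin g) ℚ) *
          (((bq γ : ↥(gspRational δ)) : GL (Fin g ⊕ Fin g) ℚ) : Matrix (Fin g ⊕ Fin g) (Fin g ⊕ Fin g) ℚ) * (ρ₀ b').map (Int.cast : ℤ → ℚ) *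
          (((((bq γ)⁻¹ : ↥(gspRational δ)) : GL (Fin g ⊕ Fin g) ℚ) : Matrix (Fin g ⊕ Fin g) (Fin g ⊕ Fin g) ℚ) *
            (((q a : ↥(gspRational δ)) : GL (Fin g ⊕ Fin g) ℚ) : Matrix (Fin g ⊕ Fin g) (Fin g ⊕ Fin g) ℚ)) =
        ((((q a)⁻¹ : ↥(gspRational δ)) : GL (Fin g ⊕ Fin g) ℚ) : Matrix (Fin g ⊕ Fin g) (Fin g ⊕ Fin g) ℚ) * (ρ₀ b').map (Int.cast : ℤ → ℚ) *
          (((q a : ↥(gspRational δ)) : GL (Fin g ⊕ Fin g) ℚ) : Matrix (Fin g ⊕ Fin g) (Fin g ⊕ Fin g) ℚ) := by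
      rw [show ((((q a)⁻¹ : ↥(gspRational δ)) : GL (Fin g ⊕ Fin g) ℚ) : Matrix (Fin g ⊕ Fin g) (Fin g ⊕ Fin g) ℚ) *
            (((bq γ : ↥(gspRational δ)) : GL (Fin g ⊕ Fin g) ℚ) : Matrix (Fin g ⊕ Fin g) (Fin g ⊕ Fin g) ℚ) * (ρ₀ b').map (Int.cast : ℤ → ℚ) *
            (((((bq γ)⁻¹ : ↥(gspRational δ)) : GL (Fin g ⊕ Fin g) ℚ) : Matrix (Fin g ⊕ Fin g) (Fin g ⊕ Fin g) ℚ) *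
              (((q a : ↥(gspRational δ)) : GL (Fin g ⊕ Fin g) ℚ) : Matrix (Fin g ⊕ Fin g) (Fin g ⊕ Fin g) ℚ)) =
          ((((q a)⁻¹ : ↥(gspRational δ)) : GL (Fin g ⊕ Fin g) ℚ) : Matrix (Fin g ⊕ Fin g) (Fin g ⊕ Fin g) ℚ) *
            ((((bq γ : ↥(gspRational δ)) : GL (Fin g ⊕ Fin g) ℚ) : Matrix (Fin g ⊕ Fin g) (Fin g ⊕ Fin g) ℚ) * (ρ₀ b').map (Int.cast : ℤ → ℚ) *
              ((((bq γ)⁻¹ : ↥(gspRational δ)) : GL (Fin g ⊕ Fin g) ℚ) : Matrix (Fin g ⊕ Fin g) (Fin g ⊕ Fin g) ℚ)) *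
            (((q a : ↥(gspRational δ)) : GL (Fin g ⊕ Fin g) ℚ) : Matrix (Fin g ⊕ Fin g) (Fin g ⊕ Fin g) ℚ) by
          simp only [Matrix.mul_assoc], hγρ]
    rw [Mρ_frame v hv a b', _root_.mul_inv_rev, inv_inv, Subgroup.coe_mul, Subgroup.coe_mul, Units.val_mul, Units.val_mul, key]

end UnitaryCurve

end Literature.AlgebraicGeometry.ShimuraVarieties

end
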